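import Summits.BirchSwinnertonDyer.BirchSwinnertonDyer.Theorems.SignedLowerHalvesSmallImageLowerHalfBothSignsRttD2UnitAuxIdeal
import Literature.NumberTheory.ComplexMultiplication.EllipticUnits.KatoLayerRamification
import Literature.NumberTheory.GaloisRepresentations.ChebotarevRestrict
import Literature.NumberTheory.GaloisRepresentations.CyclotomicCharacterFrobeniusProofs
import Literature.NumberTheory.EllipticCurves.DeShalit1987.AvatarArtinLift
import Literature.NumberTheory.EllipticCurves.Kato2004.IwasawaCohomologyCoeffExistsProofs
import HarnessLib

/-!
# Route `SignedLowerHalves`, crux L `SmallImageLowerHalfBothSigns` (stmt-BirchSwinnertonDyer-23599), line `rtt_w3` — E2, row «𝔞»: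
# SUPPLY OF AN ADMISSIBLE AUXILIARY IDEAL `𝔞` WITH `N𝔞 − χ(σ_𝔞)⁻¹ ∈ 𝒪ˣ` (Čebotarev), the EXISTENCE half of `isUnit_map_nsub_iff`

WHY (HELPER-TABLE v13 addendum 7, row «𝔞»; BRIEF-E2 rev 4 §3 row «𝔞»). Road D reads the glue's `hK` on ONE specialised zeta class
`ζ̄ = zetaSp f D 𝔞` as soon as `φ (D.nsub 𝔞)` is a unit of `Λ_𝒪` (-w3 g19 `map_mkQ_Z_eq_span_zetaSp_of_isUnit`); the LEAD's
`SmallImageRttD2LamSpec.isUnit_map_nsub_iff` (p779551) reduces this to `IsUnit ((N𝔞 : 𝒪) − χ(σ_𝔞)⁻¹)`, i.e. `N𝔞·χ(σ_𝔞) ≢ 1 (mod 𝔪_𝒪)`,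
and leaves the EXISTENCE of such an admissible `𝔞` open. This file PROVES it from the residual non-triviality «`χ̄·ω ≢ 1`», given as ONE
witness `g ∈ Γ_K` with `χ_p(g)·θ(g) ≢ 1 (mod 𝔪_𝒪)` (`χ_p` the `p`-adic cyclotomic character, `GaloisRep.cyclotomicCharacter`):

* `layerArtin_mul_inv_mem_katoLevelSubgroup` — a Frobenius `Φ ∈ Γ_K` at a prime above `𝔮 ∤ p^s𝔣` and Kato's lifted Artin symbol
  `layerArtin p 𝔣 s 𝔮` agree on `K(p^s𝔣)` (tree: `absRestrictNormalHom_rayClassField_eq_galFrob`, `absRestrictNormalHom_layerArtin_self`);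
* `cyclotomicCharacter_sub_one_mem_span_of_mem_katoLevelSubgroup_one` — `Gal(K̄/K(p𝔣))` fixes `μ_p` (tree: `K(μ_p) ⊆ K(p𝔣)` over a totally
  complex `K`), so `χ_p ≡ 1 (mod p)` on it;
* ★★ `exists_prime_isTwist_isUnit_absNorm_sub_inv` — for `𝔣 ≠ 0`, `θ : Γ_K → 𝒪ˣ` trivial on `Gal(K̄/K(𝔣))` and a witness `g`, there is, outside
  any finite set of places, a prime `𝔮` of `K` with `N𝔮` a rational prime, `𝔮` admissible (`IsTwist p 𝔣 𝔮`: prime to `6p𝔣`, `≠ 𝒪_K`) and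
  `IsUnit ((N𝔮 : 𝒪) − θ(σ_𝔮)⁻¹)`. Proof: Čebotarev with degree-one primes and prescribed restriction to the finite Galois `T = K(p𝔣)`
  (tree `GaloisRepresentations.exists_prime_absNorm_frobenius_restrict_eq`, PROVED in the tree) gives `𝔮 ∤ 6p𝔣` and a Frobenius `Φ` with
  `Φ|_{K(p𝔣)} = g|_{K(p𝔣)}`; then `θ(σ_𝔮) = θ(Φ) = θ(g)`, `χ_p(Φ) = N𝔮` (tree `GaloisRep.cyclotomicCharacter_apply_of_isArithFrobAt`) and
  `χ_p(Φ) ≡ χ_p(g) (mod p)`, so `N𝔮·θ(σ_𝔮) − 1 ≡ χ_p(g)θ(g) − 1 (mod 𝔪_𝒪)` is a unit of the local ring `𝒪` (`p ∈ 𝔪_𝒪`);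
* ★★ `exists_auxIdeal_isUnit_absNorm_sub_thetaArtinO_inv` — the same packaged on JLK's index type `AuxIdeals p 𝔣` with honda's
  `thetaArtinO S θ 𝔣 𝔞 = θ(layerArtin p 𝔣 0 𝔞)`;
* ★★★ `exists_auxIdeal_isUnit_map_nsub` — composed with `isUnit_map_nsub_iff`: `∃ 𝔞, IsUnit (φ ((D.toZetaSkeleton hreg).nsub 𝔞))` for honda's
  pinned datum `D : TwistedIwasawaDataO …` and any abstract inner evaluation `φ` at `b ∈ 𝔪_𝒪`.

The crux-side discharge of the witness `g` (which `g`; equivalently `θ̄·ω ≢ 1` on `Gal(K(p𝔣)/K)`) is NOT done here and stays with the LEAD.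
THEOREMS ONLY (`--supports stmt-BirchSwinnertonDyer-23599` helper); closes nothing; crux L, crux M, E2 and BSD remain OPEN and are proved for
NO curve by any of this.
[cite: JohnsonLeungKings2011, §5.1 (arXiv p0014:L12–43: `σ_𝔞`, `N𝔞 − σ_𝔞` for `𝔞` prime to `6p𝔣`; `𝒥_Λ` = kernel of the cyclotomic character)]
[cite: TateGCFT1967, §2.4 (Tchebotarev density theorem, existence form)] [cite: SerreAbelianLadic1968, Ch. I §1.2 (χ_ℓ(Frob_v) = Nv)]
[cite: NeukirchANT1999, Ch. VI §6 Prop. (6.7) (K(μ_m) ⊆ K^𝔪) and Ch. I §9 (9.5)]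
-/

set_option autoImplicit false
-- the Theorems namespace of this sub repeats the summit name by design (D-0017 nested layout)
set_option linter.dupNamespace false

noncomputable section

open scoped NumberField
open Field IsDedekindDomain NumberField
open Literature.NumberTheory.GaloisRepresentations
open Literature.NumberTheory.EllipticCurves
open Literature.NumberTheory.ComplexMultiplication.EllipticUnits
open Literature.NumberTheory.ComplexMultiplication.EllipticUnits.JohnsonLeungKings2011
open Literature.NumberTheory.NumberFields (rayClassField isUnramifiedIn_rayClassField)
open Literature.NumberTheory.LFunctions.AbelianDensity (artinSymbol artinSymbol_asIdeal)

namespace Summit.BirchSwinnertonDyer.BirchSwinnertonDyer.Theorems.SmallImageRttD2AuxIdeal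

variable {K : Type} [Field K] [NumberField K] {p : ℕ} [Fact p.Prime] {𝔣 : Ideal (𝓞 K)}

/-! ## §1 Galois lemmas on Kato's tower `K(p^s𝔣)` -/

/-- **A Frobenius of `Γ_K` above `𝔮 ∤ p^s𝔣` and Kato's lifted Artin symbol `layerArtin p 𝔣 s 𝔮 = lift of (𝔮, K(p^s𝔣)/K)` agree on
`K(p^s𝔣)`**: `layerArtin p 𝔣 s 𝔮 · Φ⁻¹ ∈ Gal(K̄/K(p^s𝔣))` (`K(p^s𝔣)/K` is abelian and unramified at `𝔮`, so the restriction of `Φ` is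
THE Frobenius `galFrob`, which is the Artin symbol of the prime `𝔮`). [cite: NeukirchANT1999, Ch. I §9 (9.5) and Ch. VI §7 Thm. (7.1)]
[cite: Kato2004Asterisque, §15.6 (p. 254, "(𝔞, K(p^∞𝔣)/K)")] -/
theorem layerArtin_mul_inv_mem_katoLevelSubgroup (h𝔣 : 𝔣 ≠ ⊥) (s : ℕ) {𝔮 : HeightOneSpectrum (𝓞 K)}
    (h𝔮 : ¬ katoModulus p 𝔣 s ≤ 𝔮.asIdeal) {𝔓 : Ideal (absIntegers (𝓞 K) K)} (h𝔓 : 𝔓 ∈ 𝔮.primesAbove)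
    {Φ : absoluteGaloisGroup K} (hΦ : IsArithFrobAt (𝓞 K) Φ 𝔓) :
    layerArtin p 𝔣 s 𝔮.asIdeal * Φ⁻¹ ∈ katoLevelSubgroup p 𝔣 s := by
  change _ ∈ MonoidHom.ker _
  rw [MonoidHom.mem_ker, map_mul, map_inv]
  change absRestrictNormalHom (katoLayer p 𝔣 s) (layerArtin p 𝔣 s 𝔮.asIdeal) *
      (absRestrictNormalHom (katoLayer p 𝔣 s) Φ)⁻¹ = 1
  rw [absRestrictNormalHom_layerArtin_self, artinSymbol_asIdeal,
    absRestrictNormalHom_rayClassField_eq_galFrob (katoModulus_ne_bot p 𝔣 h𝔣 s) h𝔮 h𝔓 hΦ, mul_inv_cancel]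

omit [Fact p.Prime] in
/-- **Two elements of `Γ_K` with the same restriction to `K(p^s𝔣)` differ by an element of `Gal(K̄/K(p^s𝔣))`.** [folklore] -/
theorem mul_inv_mem_katoLevelSubgroup_of_absRestrictNormalHom_eq (s : ℕ) {Φ g : absoluteGaloisGroup K}
    (h : absRestrictNormalHom (katoLayer p 𝔣 s) Φ = absRestrictNormalHom (katoLayer p 𝔣 s) g) :
    Φ * g⁻¹ ∈ katoLevelSubgroup p 𝔣 s := by
  change _ ∈ MonoidHom.ker _
  rw [MonoidHom.mem_ker, map_mul, map_inv]
  change absRestrictNormalHom (katoLayer p 𝔣 s) Φ * (absRestrictNormalHom (katoLayer p 𝔣 s) g)⁻¹ = 1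
  rw [h, mul_inv_cancel]

/-- **`χ_p ≡ 1 (mod p)` on `Gal(K̄/K(p𝔣))`** over a totally complex `K`: that group fixes `μ_p ⊂ K(p𝔣)` (tree
`smul_eq_self_of_mem_katoLevelSubgroup_of_pow_eq_one`), while `τ ζ = ζ^{χ_p(τ) mod p}` for a primitive `p`-th root of unity `ζ`.
[cite: NeukirchANT1999, Ch. VI §6 Prop. (6.7) (proof) p. 399] [cite: SerreAbelianLadic1968, Ch. I §1.2 (the cyclotomic character)] -/
theorem cyclotomicCharacter_sub_one_mem_span_of_mem_katoLevelSubgroup_one [IsTotallyComplex K] (h𝔣 : 𝔣 ≠ ⊥)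
    {τ : absoluteGaloisGroup K} (hτ : τ ∈ katoLevelSubgroup p 𝔣 1) :
    ((GaloisRep.cyclotomicCharacter K p τ : ℤ_[p]ˣ) : ℤ_[p]) - 1 ∈ Ideal.span {(p : ℤ_[p])} := by
  haveI : NeZero (p : K) := ⟨Nat.cast_ne_zero.mpr (Fact.out : p.Prime).ne_zero⟩
  haveI hp1 : Fact (1 < p ^ 1) := ⟨by rw [pow_one]; exact (Fact.out : p.Prime).one_lt⟩
  obtain ⟨ζ, hζ⟩ := HasEnoughRootsOfUnity.prim (M := AlgebraicClosure K) (n := p ^ 1)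
  have hζ1 : ζ ^ p ^ 1 = 1 := hζ.pow_eq_one
  have hfix : τ • ζ = ζ := smul_eq_self_of_mem_katoLevelSubgroup_of_pow_eq_one p 𝔣 h𝔣 (k := 1) (s := 1) le_rfl hτ hζ1
  have hspec := GaloisRep.cyclotomicCharacter_spec K p (k := 1) τ ζ hζ1
  rw [hfix] at hspec
  -- `ζ = ζ ^ a` with `a < p`, so `a = 1`
  have ha : (((GaloisRep.cyclotomicCharacter K p τ : ℤ_[p]ˣ) : ℤ_[p]).toZModPow 1).val = 1 := by
    refine hζ.pow_inj (ZMod.val_lt _) hp1.out ?_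
    calc ζ ^ (((GaloisRep.cyclotomicCharacter K p τ : ℤ_[p]ˣ) : ℤ_[p]).toZModPow 1).val = ζ := hspec.symm
      _ = ζ ^ 1 := (pow_one ζ).symm
  have ha' : ((GaloisRep.cyclotomicCharacter K p τ : ℤ_[p]ˣ) : ℤ_[p]).toZModPow 1 = 1 :=
    ZMod.val_injective _ (by rw [ha, ZMod.val_one])
  have hker : ((GaloisRep.cyclotomicCharacter K p τ : ℤ_[p]ˣ) : ℤ_[p]) - 1 ∈ RingHom.ker (PadicInt.toZModPow 1) := by
    rw [RingHom.mem_ker, map_sub, map_one, ha', sub_self]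
  rwa [PadicInt.ker_toZModPow, pow_one] at hker

/-! ## §2 The supply of admissible `𝔞` with `N𝔞 − θ(σ_𝔞)⁻¹ ∈ 𝒪ˣ` (`𝒪 = padicCoeffIntegers S`) -/

section Supply

variable (S : Set (PadicAlgCl p))

/-- In a local ring, an element congruent modulo `𝔪` to a unit is a unit. [folklore] -/
theorem isUnit_of_sub_mem_maximalIdeal {A : Type*} [CommRing A] [IsLocalRing A] {x y : A} (hy : IsUnit y)
    (h : x - y ∈ IsLocalRing.maximalIdeal A) : IsUnit x := by
  by_contra hx
  have hx' : x ∈ IsLocalRing.maximalIdeal A := (IsLocalRing.mem_maximalIdeal _).mpr hx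
  have hy' : y ∈ IsLocalRing.maximalIdeal A := by
    have := Ideal.sub_mem _ hx' h
    rwa [sub_sub_cancel] at this
  exact (IsLocalRing.mem_maximalIdeal _).mp hy' hy

omit [Fact p.Prime] in
/-- `6p𝔣 ≠ 0` for `𝔣 ≠ 0`. [cite: Kato2004Asterisque, §15.5 (p. 253)] -/
theorem katoModulus6_ne_bot (hp : p ≠ 0) (h𝔣 : 𝔣 ≠ ⊥) : katoModulus6 p 𝔣 ≠ ⊥ := by
  have h6p : (Ideal.span {((6 * p : ℕ) : 𝓞 K)} : Ideal (𝓞 K)) ≠ ⊥ := by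
    rw [Ne, Ideal.span_singleton_eq_bot]
    exact_mod_cast (mul_ne_zero (by norm_num) hp : 6 * p ≠ 0)
  rw [katoModulus6]
  exact mul_ne_zero h6p h𝔣

/-- ★★ **Supply of admissible primes `𝔮` with `N𝔮 − θ(σ_𝔮)⁻¹ ∈ 𝒪ˣ`.** Let `K` be a totally complex number field, `𝔣 ≠ 0`,
`θ : Γ_K → 𝒪ˣ` (`𝒪 = 𝒪_{ℚ_p(S)}`) continuous and trivial on `Gal(K̄/K(𝔣))`, and let `g ∈ Γ_K` witness «`χ̄_p·θ̄ ≢ 1`»: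
`χ_p(g)·θ(g) − 1 ∈ 𝒪ˣ`. Then outside any finite set `X` of places there is a prime `𝔮` of `K` with `N𝔮` a rational prime, `𝔮` prime to
`6p𝔣` (an admissible twist), and `(N𝔮 : 𝒪) − θ(σ_𝔮)⁻¹ ∈ 𝒪ˣ`, `σ_𝔮 = layerArtin p 𝔣 0 𝔮` Kato's lift of `(𝔮, K(𝔣)/K)`. Proof: Čebotarev
(`exists_prime_absNorm_frobenius_restrict_eq` for `T = K(p𝔣)`): a Frobenius `Φ` above `𝔮` with `Φ|_{K(p𝔣)} = g|_{K(p𝔣)}` has `θ(σ_𝔮) = θ(Φ)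
= θ(g)`, `χ_p(Φ) = N𝔮` and `χ_p(Φ) ≡ χ_p(g) (mod p)`, so `N𝔮·θ(σ_𝔮) − 1 ≡ χ_p(g)θ(g) − 1 (mod 𝔪_𝒪)`.
[cite: TateGCFT1967, §2.4 (Tchebotarev density theorem, existence form)] [cite: JohnsonLeungKings2011, §5.1 (arXiv p0014:L12–43)]
[cite: SerreAbelianLadic1968, Ch. I §1.2] -/
theorem exists_prime_isTwist_isUnit_absNorm_sub_inv [IsTotallyComplex K] (h𝔣 : 𝔣 ≠ ⊥)
    (θ : absoluteGaloisGroup K →ₜ* (padicCoeffIntegers S)ˣ)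
    (hθ𝔣 : ∀ σ ∈ absGaloisFixingSubgroup (rayClassField K 𝔣), θ σ = 1) {g : absoluteGaloisGroup K}
    (hg : IsUnit (padicIntToCoeffIntegers S ((GaloisRep.cyclotomicCharacter K p g : ℤ_[p]ˣ) : ℤ_[p]) *
      ((θ g : (padicCoeffIntegers S)ˣ) : padicCoeffIntegers S) - 1))
    (X : Set (HeightOneSpectrum (𝓞 K))) (hX : X.Finite) :
    ∃ 𝔮 : HeightOneSpectrum (𝓞 K), 𝔮 ∉ X ∧ (Ideal.absNorm 𝔮.asIdeal).Prime ∧ IsTwist p 𝔣 𝔮.asIdeal ∧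
      IsUnit ((Ideal.absNorm 𝔮.asIdeal : padicCoeffIntegers S) -
        (((θ (layerArtin p 𝔣 0 𝔮.asIdeal))⁻¹ : (padicCoeffIntegers S)ˣ) : padicCoeffIntegers S)) := by
  classical
  haveI : IsLocalRing (padicCoeffIntegers S) := isLocalRing_padicCoeffIntegers S
  have hp0 : p ≠ 0 := (Fact.out : p.Prime).ne_zero
  -- the finite set of places dividing `6p𝔣`
  set B : Set (HeightOneSpectrum (𝓞 K)) := {v | v.asIdeal ∣ katoModulus6 p 𝔣} with hB
  have hBfin : B.Finite := Ideal.finite_factors (katoModulus6_ne_bot (K := K) hp0 h𝔣)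
  -- Čebotarev with prescribed restriction to `T = K(p𝔣)`
  obtain ⟨𝔮, h𝔮XB, hprime, -, 𝔓, h𝔓, Φ, hΦ, hres⟩ :=
    exists_prime_absNorm_frobenius_restrict_eq (katoLayer p 𝔣 1) g (X ∪ B) (hX.union hBfin)
  rw [Set.mem_union, not_or] at h𝔮XB
  obtain ⟨h𝔮X, h𝔮B⟩ := h𝔮XB
  have h6 : ¬ katoModulus6 p 𝔣 ≤ 𝔮.asIdeal := fun h ↦ h𝔮B (by rw [hB, Set.mem_setOf_eq, Ideal.dvd_iff_le]; exact h)
  have hmax : 𝔮.asIdeal.IsMaximal := 𝔮.isPrime.isMaximal 𝔮.ne_bot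
  have hcop : IsCoprime 𝔮.asIdeal (katoModulus6 p 𝔣) := by
    rw [Ideal.isCoprime_iff_sup_eq]
    exact hmax.1.2 _ (lt_of_le_of_ne le_sup_left fun h ↦ h6 (h.symm ▸ le_sup_right))
  have htwist : IsTwist p 𝔣 𝔮.asIdeal := ⟨hcop, 𝔮.isPrime.ne_top⟩
  -- `𝔮 ∤ p` and `𝔮 ∤ 𝔣`
  have hp𝔮 : ((p : ℕ) : 𝓞 K) ∉ 𝔮.asIdeal := by
    intro h
    apply h6
    rw [katoModulus6]
    refine Ideal.mul_le_right.trans ((Ideal.span_singleton_le_span_singleton.mpr ?_).trans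
      ((Ideal.span_singleton_le_iff_mem _).mpr h))
    exact ⟨(6 : ℕ), by push_cast; ring⟩
  have h6𝔣 : katoModulus6 p 𝔣 ≤ 𝔣 := by
    rw [katoModulus6]
    exact Ideal.mul_le_left
  have h𝔣𝔮 : ¬ katoModulus p 𝔣 0 ≤ 𝔮.asIdeal := by
    intro h
    rw [katoModulus_zero] at h
    exact h6 (h6𝔣.trans h)
  -- `θ(σ_𝔮) = θ(Φ) = θ(g)`
  have hKL : (katoLayer p 𝔣 0 : IntermediateField K (AlgebraicClosure K)) = rayClassField K 𝔣 := by
    change rayClassField K (katoModulus p 𝔣 0) = rayClassField K 𝔣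
    rw [katoModulus_zero]
  have hθ0 : ∀ σ ∈ katoLevelSubgroup p 𝔣 0, θ σ = 1 := fun σ hσ ↦
    hθ𝔣 σ ((mem_absGaloisFixingSubgroup_iff _ σ).mpr fun x hx ↦
      (mem_absGaloisFixingSubgroup_iff _ σ).mp hσ x (by rw [hKL]; exact hx))
  have hA := layerArtin_mul_inv_mem_katoLevelSubgroup (p := p) h𝔣 0 h𝔣𝔮 h𝔓 hΦ
  have hBmem : Φ * g⁻¹ ∈ katoLevelSubgroup p 𝔣 1 := mul_inv_mem_katoLevelSubgroup_of_absRestrictNormalHom_eq 1 hres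
  have hB0 : Φ * g⁻¹ ∈ katoLevelSubgroup p 𝔣 0 := katoLevelSubgroup_antitone p 𝔣 h𝔣 (Nat.zero_le 1) hBmem
  have hθA : θ (layerArtin p 𝔣 0 𝔮.asIdeal) = θ Φ := by
    have h := hθ0 _ hA
    rwa [map_mul, map_inv, mul_inv_eq_one] at h
  have hθB : θ Φ = θ g := by
    have h := hθ0 _ hB0
    rwa [map_mul, map_inv, mul_inv_eq_one] at h
  -- `χ_p(Φ) = N𝔮` and `χ_p(Φ) ≡ χ_p(g) (mod p)`
  have hχΦ : ((GaloisRep.cyclotomicCharacter K p Φ : ℤ_[p]ˣ) : ℤ_[p]) = (Ideal.absNorm 𝔮.asIdeal : ℤ_[p]) :=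
    GaloisRep.cyclotomicCharacter_apply_of_isArithFrobAt hp𝔮 h𝔓 hΦ
  obtain ⟨c, hc⟩ := Ideal.mem_span_singleton'.mp
    (cyclotomicCharacter_sub_one_mem_span_of_mem_katoLevelSubgroup_one (p := p) h𝔣 hBmem)
  have hχ : (Ideal.absNorm 𝔮.asIdeal : ℤ_[p]) =
      ((GaloisRep.cyclotomicCharacter K p g : ℤ_[p]ˣ) : ℤ_[p]) +
        (p : ℤ_[p]) * (c * ((GaloisRep.cyclotomicCharacter K p g : ℤ_[p]ˣ) : ℤ_[p])) := by
    rw [← hχΦ, show Φ = Φ * g⁻¹ * g by rw [inv_mul_cancel_right], map_mul, Units.val_mul,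
      show ((GaloisRep.cyclotomicCharacter K p (Φ * g⁻¹) : ℤ_[p]ˣ) : ℤ_[p]) = 1 + c * (p : ℤ_[p]) by
        linear_combination -hc]
    ring
  -- reduce modulo `𝔪_𝒪`
  have hpm : ((p : ℕ) : padicCoeffIntegers S) ∈ IsLocalRing.maximalIdeal (padicCoeffIntegers S) :=
    Kato2004.IwasawaH1CoeffExists.natCast_mem_maximalIdeal_padicCoeffIntegers p S
  have hNι : ((Ideal.absNorm 𝔮.asIdeal : ℕ) : padicCoeffIntegers S) =
      padicIntToCoeffIntegers S ((GaloisRep.cyclotomicCharacter K p g : ℤ_[p]ˣ) : ℤ_[p]) +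
        ((p : ℕ) : padicCoeffIntegers S) *
          padicIntToCoeffIntegers S (c * ((GaloisRep.cyclotomicCharacter K p g : ℤ_[p]ˣ) : ℤ_[p])) := by
    rw [← map_natCast (padicIntToCoeffIntegers S) (Ideal.absNorm 𝔮.asIdeal), hχ, map_add, map_mul, map_natCast]
  have hunit : IsUnit (((Ideal.absNorm 𝔮.asIdeal : ℕ) : padicCoeffIntegers S) *
      ((θ g : (padicCoeffIntegers S)ˣ) : padicCoeffIntegers S) - 1) := by
    refine isUnit_of_sub_mem_maximalIdeal hg ?_
    have key : ((Ideal.absNorm 𝔮.asIdeal : ℕ) : padicCoeffIntegers S) * ((θ g : (padicCoeffIntegers S)ˣ) : padicCoeffIntegers S) - 1 -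
        (padicIntToCoeffIntegers S ((GaloisRep.cyclotomicCharacter K p g : ℤ_[p]ˣ) : ℤ_[p]) *
          ((θ g : (padicCoeffIntegers S)ˣ) : padicCoeffIntegers S) - 1) =
        ((p : ℕ) : padicCoeffIntegers S) *
          (padicIntToCoeffIntegers S (c * ((GaloisRep.cyclotomicCharacter K p g : ℤ_[p]ˣ) : ℤ_[p])) *
            ((θ g : (padicCoeffIntegers S)ˣ) : padicCoeffIntegers S)) := by
      rw [hNι]; ring
    rw [key]
    exact Ideal.mul_mem_right _ _ hpm
  refine ⟨𝔮, h𝔮X, hprime, htwist, ?_⟩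
  rw [hθA, hθB]
  have key : ((Ideal.absNorm 𝔮.asIdeal : ℕ) : padicCoeffIntegers S) - (((θ g)⁻¹ : (padicCoeffIntegers S)ˣ) : padicCoeffIntegers S) =
      (((θ g)⁻¹ : (padicCoeffIntegers S)ˣ) : padicCoeffIntegers S) *
        (((Ideal.absNorm 𝔮.asIdeal : ℕ) : padicCoeffIntegers S) * ((θ g : (padicCoeffIntegers S)ˣ) : padicCoeffIntegers S) - 1) := by
    rw [mul_sub, mul_one, mul_comm ((Ideal.absNorm 𝔮.asIdeal : ℕ) : padicCoeffIntegers S), ← mul_assoc, Units.inv_mul, one_mul]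
  rw [key]
  exact (Units.isUnit _).mul hunit

/-- ★★ **Supply of an admissible `𝔞 ∈ AuxIdeals p 𝔣` with `IsUnit ((N𝔞 : 𝒪) − (thetaArtinO S θ 𝔣 𝔞)⁻¹)`** — the right-hand side of the LEAD's
`isUnit_map_nsub_iff` — from ONE witness `g ∈ Γ_K` of «`χ̄_p·θ̄ ≢ 1 (mod 𝔪_𝒪)`» (`K` totally complex, `𝔣 ≠ 0`, `θ` trivial on `Gal(K̄/K(𝔣))`).
The `𝔞` produced is a prime `𝔮 ∤ 6p𝔣` of prime absolute norm. [cite: JohnsonLeungKings2011, §5.1 (arXiv p0014:L12–43)]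
[cite: TateGCFT1967, §2.4 (Tchebotarev density theorem, existence form)] -/
theorem exists_auxIdeal_isUnit_absNorm_sub_thetaArtinO_inv [IsTotallyComplex K] (h𝔣 : 𝔣 ≠ ⊥)
    (θ : absoluteGaloisGroup K →ₜ* (padicCoeffIntegers S)ˣ)
    (hθ𝔣 : ∀ σ ∈ absGaloisFixingSubgroup (rayClassField K 𝔣), θ σ = 1) {g : absoluteGaloisGroup K}
    (hg : IsUnit (padicIntToCoeffIntegers S ((GaloisRep.cyclotomicCharacter K p g : ℤ_[p]ˣ) : ℤ_[p]) *
      ((θ g : (padicCoeffIntegers S)ˣ) : padicCoeffIntegers S) - 1)) :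
    ∃ 𝔞 : AuxIdeals p 𝔣, IsUnit ((Ideal.absNorm 𝔞.1 : padicCoeffIntegers S) -
      (((thetaArtinO S θ 𝔣 𝔞)⁻¹ : (padicCoeffIntegers S)ˣ) : padicCoeffIntegers S)) := by
  obtain ⟨𝔮, -, -, htwist, hunit⟩ := exists_prime_isTwist_isUnit_absNorm_sub_inv S h𝔣 θ hθ𝔣 hg ∅ Set.finite_empty
  exact ⟨⟨𝔮.asIdeal, htwist⟩, hunit⟩

end Supply

/-! ## §3 Composition with `isUnit_map_nsub_iff`: a unit `φ (N𝔞 − σ_𝔞)` for honda's pinned datum -/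

section Honda

open PowerSeries

variable {S : Set (PadicAlgCl p)} {κ₁ κ₂ : ZpExtension K p} {γ₁ γ₂ : absoluteGaloisGroup K}
  {θ : absoluteGaloisGroup K →ₜ* (padicCoeffIntegers S)ˣ} {ι : K →+* ℂ}
  (D : TwistedIwasawaDataO S κ₁ κ₂ γ₁ γ₂ θ 𝔣 ι)

/-- ★★★ **There is an admissible `𝔞` with `φ (N𝔞 − σ_𝔞)` a unit of `Λ_𝒪 = 𝒪⟦T⟧`** for honda's pinned datum `D : TwistedIwasawaDataO …`
(`…ImaginaryQuadraticMainConjectureCarriersO`, p776397) and any abstract inner evaluation `φ : 𝒪⟦T₂⟧⟦T₁⟧ → 𝒪⟦T⟧` at a point `b ∈ 𝔪_𝒪`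
(`φ (C (C a)) = C a`, `φ X = X`, `φ (C (X − C b)) = 0`), provided `K` is totally complex, `𝔣 ≠ 0`, `θ` factors through `Gal(K(𝔣)/K)` and
`g ∈ Γ_K` witnesses «`χ̄_p·θ̄ ≢ 1`» — the LEAD's `isUnit_map_nsub_iff` (p779551) composed with `exists_auxIdeal_isUnit_absNorm_sub_thetaArtinO_inv`;
this is the hypothesis of -w3 g19's `map_mkQ_Z_eq_span_zetaSp_of_isUnit` (the specialised zeta module is cyclic on `ζ̄ = zetaSp f D 𝔞`).
[cite: JohnsonLeungKings2011, §5.1–§5.2 (arXiv p0014:L12–43, L80–99)] [cite: TateGCFT1967, §2.4 (Tchebotarev density theorem, existence form)] -/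
theorem exists_auxIdeal_isUnit_map_nsub [IsTotallyComplex K] [IsLocalRing (padicCoeffIntegers S)] (h𝔣 : 𝔣 ≠ ⊥)
    (hθ𝔣 : ∀ σ ∈ absGaloisFixingSubgroup (rayClassField K 𝔣), θ σ = 1) {g : absoluteGaloisGroup K}
    (hg : IsUnit (padicIntToCoeffIntegers S ((GaloisRep.cyclotomicCharacter K p g : ℤ_[p]ˣ) : ℤ_[p]) *
      ((θ g : (padicCoeffIntegers S)ˣ) : padicCoeffIntegers S) - 1))
    {b : padicCoeffIntegers S} (hb : b ∈ IsLocalRing.maximalIdeal (padicCoeffIntegers S))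
    (φ : PowerSeries (IwasawaAlgebraO S) →+* IwasawaAlgebraO S)
    (hφf : φ (C (X - C b)) = 0) (hC : ∀ a : padicCoeffIntegers S, φ (C (C a)) = C a) (hX : φ X = X)
    (hreg : ∀ a : AuxIdeals p 𝔣, IsSMulRegular (IwasawaAlgebraO₂ S) (D.nsub a)) :
    ∃ 𝔞 : AuxIdeals p 𝔣, IsUnit (φ ((D.toZetaSkeleton hreg).nsub 𝔞)) := by
  obtain ⟨𝔞, h𝔞⟩ := exists_auxIdeal_isUnit_absNorm_sub_thetaArtinO_inv S h𝔣 θ hθ𝔣 hg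
  exact ⟨𝔞, (SmallImageRttD2LamSpec.isUnit_map_nsub_iff D hb φ hφf hC hX hreg 𝔞).mpr h𝔞⟩

end Honda

end Summit.BirchSwinnertonDyer.BirchSwinnertonDyer.Theorems.SmallImageRttD2AuxIdeal

end
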